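import Summits.QuantumFields.BalabanUV.Beta.D1BFx.AssemblySlots
import Summits.QuantumFields.BalabanUV.Beta.D1BFx.ReducedKernelSandwichBlock
import Summits.QuantumFields.BalabanUV.Beta.D1BFx.ReducedTableBridge
import Summits.QuantumFields.BalabanUV.Beta.D1BFx.FineStencilBFBalaban
import Summits.QuantumFields.BalabanUV.Beta.D1BFx.SecondStencilBF

/-!
# Road BF-x, slot (F) for the R-weighted gluon piece: the BLOCK-COVARIANT junction

Owner file of road «BF-x» (BINDER-OWNERS row D1, co-owner d1-p2), A7 slot (F)/(CONV) for the gluon piece of record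
`TOfRed n a (SbfBal n a cE cVH cΛ cR cK cQ) (tableRed n (Wbf …))`.

WHY THIS FILE.  `AssemblySlots.hF_TOfRed` (p219331) consumes leaf-01's A4 END `ReducedKernelSandwich.secondMoment_TOfRed_eq`, whose
stencil / table covariance sockets are FINE-translation covariance (`S κ′ (u + v) = shiftK (−v) (S κ′ u)` for EVERY `v`).  Bałaban's
R-weighted first-order stencil `SbfBal` and the second-order table `Wbf` are only BLOCK-covariant (`FineStencilBFBalaban.SbfBal_translate_block`,
`SecondStencilBF.Wbf_translate_block`: shifts by `n•t`), so that END does not apply to the road's actual gluon piece.  The block-covariant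
A4 chain exists (`ReducedKernelSandwichBlock.secondMoment_TOfLeg_eq_of_block`, generic leg); this file is the one-screen junction:

* §1 `hF_TOfRed_of_block` / `conv_TOfRed'` — slot (F) / (CONV) for `TOfRed n a S (tableRed n Wf)` from BLOCK covariance of `S`, `Wf`
  (bridge `ReducedTableBridge.TOfLeg_tableRedF_eq_TOfRed_tableRed` + `ReducedKernelSandwichLeg.fineHessA_Ga`, both definitional up to the
  table bridge).
* §2 `hF_SbfBal` / `conv_SbfBal` — the same SPECIALISED to `S := SbfBal …`, `Wf := Wbf …`: every localisation / covariance / symmetry socket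
  is DISCHARGED from the binder-free facts of `FineStencilBFBalaban` and `SecondStencilBF` given the five slot tables `WE WJ WΛ WR WQ`
  bi-localised at one common rate, block-covariant and bond-swap symmetric; what REMAINS displayed is exactly: the leg binder `Spr (Ga n a)`,
  the Ward rows `hrow` and the base-point-summed first moments `hT1` of `fineHess` (K-R5's two analytic inputs; cf. leaf-02-g4's
  «hT1-KRONECKER-WARD» files for the route that removes `hT1` at the road's entry).

HONEST STATUS: junction lemmas [folklore]; no cited facts; nothing about the wall.  D1 NOT discharged.  HONEST DEPENDENCY: continuum YM on T⁴ ⇐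
BetaPertH ∧ nine spine estimates (0/9 proved); BetaPertH ⇐ (D1) ∧ (D4) ∧ CAP+tail; G-an2-4 gates asym, D1 and NE2/3/4.
-/

open Finset Filter Topology
open scoped BigOperators
open Literature.MathematicalPhysics.QuantumFieldTheory.Balaban1983to89
open Literature.MathematicalPhysics.QuantumFieldTheory.Balaban1983to89.Beta
open WindowIdentification (fullSum psum)
open DyadicShell (Pt toReal)
open ExpKernelCalculus (Site MKer BiLoc shiftK)
open DressedMomentNormalisation (resSite)
open Summit.QuantumFields.BalabanUV.Beta.TameKernelCalculus (Spr biLoc_of_le)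
open Summit.QuantumFields.BalabanUV.Beta.D1BFx.MomentTransferPeriodic (baseKer)
open Summit.QuantumFields.BalabanUV.Beta.D1BFx.GluonLeg (Ga shiftK_Ga_neg)
open Summit.QuantumFields.BalabanUV.Beta.D1BFx.ReducedKernel (StencilR TableR TOfRed)
open Summit.QuantumFields.BalabanUV.Beta.D1BFx.DressedTadpoleTable (Table₂R tableRed)
open Summit.QuantumFields.BalabanUV.Beta.D1BFx.ReducedKernelSandwich (fineHess absMoment₂_baseKer_fineHess)
open Summit.QuantumFields.BalabanUV.Beta.D1BFx.ReducedKernelSandwichLeg (fineHessA_Ga)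
open Summit.QuantumFields.BalabanUV.Beta.D1BFx.ReducedKernelSandwichBlock (secondMoment_TOfLeg_eq_of_block)
open Summit.QuantumFields.BalabanUV.Beta.D1BFx.ReducedTableBridge (TOfLeg_tableRedF_eq_TOfRed_tableRed)
open Summit.QuantumFields.BalabanUV.Beta.D1BFx.FineStencilBFBalaban (SbfBal exists_biLoc_SbfBal SbfBal_translate_block)
open Summit.QuantumFields.BalabanUV.Beta.D1BFx.SecondStencilBF (Wbf biLoc_Wbf Wbf_symm Wbf_translate_block)
open Summit.QuantumFields.BalabanUV.Beta.D1BFx.AssemblySlots (secondMoment_eq_avg_fullSum conv_TOfRed)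

namespace Summit.QuantumFields.BalabanUV.Beta.D1BFx.AssemblySlotsBal

/-! ## §1 Slot (F) for the reduced gluon kernel under BLOCK covariance -/

section Block

variable (n : ℕ) [NeZero n] (a : ℝ) {S : StencilR} {Wf : Table₂R} {Cs C2 δ : ℝ}

/-- [folklore] **SLOT (F) FOR `TOfRed n a S (tableRed n Wf)` UNDER BLOCK COVARIANCE**: as `AssemblySlots.hF_TOfRed` but with the stencil /
table covariance sockets weakened to BLOCK translations `u ↦ u + n•t` (the shape Bałaban's R-weighted stencils actually have), via
`ReducedKernelSandwichBlock.secondMoment_TOfLeg_eq_of_block` at the gluon leg and the table bridge. -/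
theorem hF_TOfRed_of_block (hn : 1 ≤ n) (hGa : Spr (Ga n a)) (hS : ∀ κ' u, BiLoc (S κ' u) u u Cs δ)
    (hW : ∀ κ' u l' u', BiLoc (Wf κ' u l' u') u u' C2 δ) (hδ : 0 < δ)
    (hScov : ∀ (κ' : Fin 4) (u t : Site 4), S κ' (u + (n : ℤ) • t) = shiftK (-((n : ℤ) • t)) (S κ' u))
    (hWcov : ∀ (κ' : Fin 4) (u : Site 4) (l' : Fin 4) (u' t : Site 4),
      Wf κ' (u + (n : ℤ) • t) l' (u' + (n : ℤ) • t) = shiftK (-((n : ℤ) • t)) (Wf κ' u l' u'))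
    (hWsymm : ∀ (κ' : Fin 4) (u : Site 4) (l' : Fin 4) (u' : Site 4), Wf κ' u l' u' = Wf l' u' κ' u)
    (hrow : ∀ (κ' l' : Fin 4) (b : Site 4), HasSum (fineHess n a S Wf κ' l' b) 0)
    (hT1 : ∀ (κ' l' μ' : Fin 4), ∑ r : Fin 4 → Fin n, ∑' t, (t μ' : ℝ) * baseKer (fineHess n a S Wf κ' l') (resSite r) t = 0)
    (μ ν : Fin 4) :
    B12Beta.secondMoment (TOfRed n a S (tableRed n Wf)) μ ν =
      ∑ b ∈ (univ : Finset (Fin 4 → Fin n)).image resSite, ((n : ℝ) ^ 4)⁻¹ *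
        fullSum (fun w : Pt => ((n : ℝ) ^ 8)⁻¹ * (toReal w μ * toReal w ν * baseKer (fineHess n a S Wf μ ν) b w)) := by
  refine secondMoment_eq_avg_fullSum ?_ fun r => absMoment₂_baseKer_fineHess n a hGa hS hW hδ μ ν (resSite r)
  have h := secondMoment_TOfLeg_eq_of_block n (Ga n a) hGa (shiftK_Ga_neg n a hn) hS hW hδ hScov hWcov hWsymm
    (by rw [fineHessA_Ga]; exact hrow) (by rw [fineHessA_Ga]; exact hT1) μ ν μ ν
  rw [TOfLeg_tableRedF_eq_TOfRed_tableRed n a S hW hδ, fineHessA_Ga] at h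
  exact h

end Block

/-! ## §2 Slots (F) and (CONV) for Bałaban's R-weighted gluon piece `TOfRed n a SbfBal (tableRed n Wbf)` -/

section Bal

variable (n : ℕ) [NeZero n] (a cE cVH cΛ cR cK cQ cE₂ cJ4 cΛ₂ cR₂ cQ₂ : ℝ) {WE WJ WΛ WR WQ : TableR} {CE CJ CΛ CR CQ δW : ℝ}

/-- [folklore] **SLOT (F) FOR THE GLUON PIECE OF RECORD** `TOfRed n a (SbfBal n a cE cVH cΛ cR cK cQ) (tableRed n (Wbf cE₂ cJ4 cΛ₂ cR₂ cQ₂ WE WJ WΛ WR WQ))`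
with EVERY localisation / covariance / symmetry socket DISCHARGED: given `1 ≤ n`, `0 < a`, the leg binder `Spr (Ga n a)`, the five slot tables
bi-localised at one common rate `δW > 0`, block-covariant (negative convention) and bond-swap symmetric, and K-R5's two analytic inputs `hrow`, `hT1`. -/
theorem hF_SbfBal (hn : 1 ≤ n) (ha : 0 < a) (hGa : Spr (Ga n a)) (hδW : 0 < δW)
    (hE : ∀ κ u l u', BiLoc (WE κ u l u') u u' CE δW) (hJ : ∀ κ u l u', BiLoc (WJ κ u l u') u u' CJ δW)
    (hΛ : ∀ κ u l u', BiLoc (WΛ κ u l u') u u' CΛ δW) (hR : ∀ κ u l u', BiLoc (WR κ u l u') u u' CR δW)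
    (hQ : ∀ κ u l u', BiLoc (WQ κ u l u') u u' CQ δW)
    (hEc : ∀ (κ : Fin 4) (u : Site 4) (l : Fin 4) (u' t : Site 4), WE κ (u + (n : ℤ) • t) l (u' + (n : ℤ) • t) = shiftK (-((n : ℤ) • t)) (WE κ u l u'))
    (hJc : ∀ (κ : Fin 4) (u : Site 4) (l : Fin 4) (u' t : Site 4), WJ κ (u + (n : ℤ) • t) l (u' + (n : ℤ) • t) = shiftK (-((n : ℤ) • t)) (WJ κ u l u'))
    (hΛc : ∀ (κ : Fin 4) (u : Site 4) (l : Fin 4) (u' t : Site 4), WΛ κ (u + (n : ℤ) • t) l (u' + (n : ℤ) • t) = shiftK (-((n : ℤ) • t)) (WΛ κ u l u'))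
    (hRc : ∀ (κ : Fin 4) (u : Site 4) (l : Fin 4) (u' t : Site 4), WR κ (u + (n : ℤ) • t) l (u' + (n : ℤ) • t) = shiftK (-((n : ℤ) • t)) (WR κ u l u'))
    (hQc : ∀ (κ : Fin 4) (u : Site 4) (l : Fin 4) (u' t : Site 4), WQ κ (u + (n : ℤ) • t) l (u' + (n : ℤ) • t) = shiftK (-((n : ℤ) • t)) (WQ κ u l u'))
    (hEs : ∀ κ u l u', WE κ u l u' = WE l u' κ u) (hJs : ∀ κ u l u', WJ κ u l u' = WJ l u' κ u) (hΛs : ∀ κ u l u', WΛ κ u l u' = WΛ l u' κ u)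
    (hRs : ∀ κ u l u', WR κ u l u' = WR l u' κ u) (hQs : ∀ κ u l u', WQ κ u l u' = WQ l u' κ u)
    (hrow : ∀ (κ' l' : Fin 4) (b : Site 4),
      HasSum (fineHess n a (SbfBal n a cE cVH cΛ cR cK cQ) (Wbf cE₂ cJ4 cΛ₂ cR₂ cQ₂ WE WJ WΛ WR WQ) κ' l' b) 0)
    (hT1 : ∀ (κ' l' μ' : Fin 4), ∑ r : Fin 4 → Fin n, ∑' t, (t μ' : ℝ) *
      baseKer (fineHess n a (SbfBal n a cE cVH cΛ cR cK cQ) (Wbf cE₂ cJ4 cΛ₂ cR₂ cQ₂ WE WJ WΛ WR WQ) κ' l') (resSite r) t = 0)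
    (μ ν : Fin 4) :
    B12Beta.secondMoment (TOfRed n a (SbfBal n a cE cVH cΛ cR cK cQ) (tableRed n (Wbf cE₂ cJ4 cΛ₂ cR₂ cQ₂ WE WJ WΛ WR WQ))) μ ν =
      ∑ b ∈ (univ : Finset (Fin 4 → Fin n)).image resSite, ((n : ℝ) ^ 4)⁻¹ *
        fullSum (fun w : Pt => ((n : ℝ) ^ 8)⁻¹ * (toReal w μ * toReal w ν *
          baseKer (fineHess n a (SbfBal n a cE cVH cΛ cR cK cQ) (Wbf cE₂ cJ4 cΛ₂ cR₂ cQ₂ WE WJ WΛ WR WQ) μ ν) b w)) := by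
  obtain ⟨Cs, δS, hδS, hS⟩ := exists_biLoc_SbfBal n a ha cE cVH cΛ cR cK cQ
  have hW := biLoc_Wbf (cE₂ := cE₂) (cJ4 := cJ4) (cΛ₂ := cΛ₂) (cR₂ := cR₂) (cQ₂ := cQ₂) hE hJ hΛ hR hQ
  exact hF_TOfRed_of_block n a hn hGa (fun κ' u => biLoc_of_le (hS κ' u) (min_le_left δS δW))
    (fun κ' u l' u' => biLoc_of_le (hW κ' u l' u') (min_le_right δS δW)) (lt_min hδS hδW)
    (SbfBal_translate_block n a ha cE cVH cΛ cR cK cQ) (Wbf_translate_block hEc hJc hΛc hRc hQc) (Wbf_symm hEs hJs hΛs hRs hQs)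
    hrow hT1 μ ν

/-- [folklore] **SLOT (CONV) FOR THE GLUON PIECE OF RECORD** — localisation only: `0 < a`, the leg binder, the five slot tables bi-localised at
one common positive rate.  No Ward / parity / covariance input. -/
theorem conv_SbfBal (ha : 0 < a) (hGa : Spr (Ga n a)) (hδW : 0 < δW)
    (hE : ∀ κ u l u', BiLoc (WE κ u l u') u u' CE δW) (hJ : ∀ κ u l u', BiLoc (WJ κ u l u') u u' CJ δW)
    (hΛ : ∀ κ u l u', BiLoc (WΛ κ u l u') u u' CΛ δW) (hR : ∀ κ u l u', BiLoc (WR κ u l u') u u' CR δW)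
    (hQ : ∀ κ u l u', BiLoc (WQ κ u l u') u u' CQ δW) (μ ν : Fin 4) :
    ∀ b ∈ (univ : Finset (Fin 4 → Fin n)).image resSite,
      ∃ B, Tendsto (psum (fun w : Pt => ((n : ℝ) ^ 8)⁻¹ * (toReal w μ * toReal w ν *
        baseKer (fineHess n a (SbfBal n a cE cVH cΛ cR cK cQ) (Wbf cE₂ cJ4 cΛ₂ cR₂ cQ₂ WE WJ WΛ WR WQ) μ ν) b w))) atTop (𝓝 B) := by
  obtain ⟨Cs, δS, hδS, hS⟩ := exists_biLoc_SbfBal n a ha cE cVH cΛ cR cK cQ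
  have hW := biLoc_Wbf (cE₂ := cE₂) (cJ4 := cJ4) (cΛ₂ := cΛ₂) (cR₂ := cR₂) (cQ₂ := cQ₂) hE hJ hΛ hR hQ
  exact conv_TOfRed n a hGa (fun κ' u => biLoc_of_le (hS κ' u) (min_le_left δS δW))
    (fun κ' u l' u' => biLoc_of_le (hW κ' u l' u') (min_le_right δS δW)) (lt_min hδS hδW) μ ν

end Bal

end Summit.QuantumFields.BalabanUV.Beta.D1BFx.AssemblySlotsBal
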